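import Literature.Topology.FourManifolds.LeeRasmussenTwistProofs
import HarnessLib

/-!
# Contraction of the free cubes of Lee's complex (given the merge/split dichotomy)

Sibling file of `LeeRasmussen.lean` on the way to Lee's theorem `finrank_leeHomologyZero_eq_two`
(Lee (2005), Thm. 4.2). In Lee's coordinates the Lee differential is the label-preserving matrix
`D = leeDiffMat` (`LeeRasmussenTwistProofs`): the generator `(σ, ℓ)` goes to the sum over the
*free* `0`-smoothed chords `i` of `ℓ` of `ε(σ,i) c_i(σ,ℓ) (σ[i ↦ 1], ℓ)`, with nonzero
coefficients `c_i` under the merge/split dichotomy (`leeCoef_ne_zero`). Hence the summand of a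
labelling `ℓ` with at least one free chord is a cube with invertible edges, contractible by the
standard homotopy along its least free chord `i₀`; the summands of the labellings with no free
chord (Lee's canonical states, `LeeRasmussenLabProofs`) have zero differential. This file
writes the homotopy and the projector as matrices and proves the homotopy identity:

* `leeHtpyMat k' k` — `H (σ, ℓ) = (ε(τ,i₀) c_{i₀}(τ,ℓ))⁻¹ (τ, ℓ)` with `τ = σ[i₀ ↦ 0]` when the
  least free chord `i₀` of `ℓ` is `1`-smoothed in `σ`, and `0` otherwise;
* `leeProjMat k` — the diagonal projector onto the generators whose labelling has no free chord;
* `leeDiffMat_mul_leeHtpyMat_add` — **`D H + H D = 1 - Π`** (given the dichotomy; the only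
  nontrivial coefficient is the anticommutativity of a face, `leeFace_eq_zero`);
* `leeProjMat_mul_leeDiffMat`, `leeDiffMat_mul_leeProjMat`, `leeProjMat_mul_leeProjMat` —
  `Π D = 0`, `D Π = 0`, `Π² = Π`.

This is the chain-level form of Lee (2005), §4.4.3 / Rasmussen (2010), §2.3 (Lee homology is
spanned by the canonical generators), in the spirit of the cancellation proofs of
Bar-Natan–Morrison (2006) and Wehrli (2008).

## References

* E. S. Lee, *An endomorphism of the Khovanov invariant*, Adv. Math. 197 (2005) 554–586,
  Thm. 4.2, §4.4.3. [cite: Lee2005, Thm. 4.2]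
* J. Rasmussen, *Khovanov homology and the slice genus*, Invent. Math. 182 (2010), §2.3.
  [cite: Rasmussen2010, §2.3]
* D. Bar-Natan, S. Morrison, *The Karoubi envelope and Lee's degeneration of Khovanov
  homology*, Algebr. Geom. Topol. 6 (2006) 1459–1469.
-/

open Function Set Matrix

noncomputable section

namespace Literature.Topology.FourManifolds

namespace GaussDiagram

variable {G : GaussDiagram}

/-! ## Entries of the label-preserving Lee matrix -/

/-- The entry of `leeDiffMat` between a generator and its image along the flip of a `0`-smoothed
chord. [folklore] -/
theorem leeDiffMat_apply_of_update {k k' : ℤ} (u : G.degStates k') (s : G.degStates k)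
    {i : Fin G.n} (hi : s.1.state i = false) (hu : u.1.state = Function.update s.1.state i true)
    (hl : u.1.label = s.1.label) :
    G.leeDiffMat k k' u s = (edgeSign s.1.state i : ℚ) * G.leeCoef s.1.state i s.1.label := by
  unfold leeDiffMat
  rw [Matrix.of_apply, Finset.sum_eq_single i]
  · rw [if_pos ⟨hi, hu, hl⟩]
  · intro j _ hji
    rw [if_neg]
    rintro ⟨-, hj, -⟩
    exact hji (eq_of_update_eq_update hi (hu.symm.trans hj))
  · exact fun h ↦ absurd (Finset.mem_univ i) h

/-- The entries of `leeDiffMat` vanish between generators not related by the flip of a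
`0`-smoothed chord with equal labellings. [folklore] -/
theorem leeDiffMat_apply_eq_zero {k k' : ℤ} (u : G.degStates k') (s : G.degStates k)
    (h : ¬ ∃ i, s.1.state i = false ∧ u.1.state = Function.update s.1.state i true ∧
      u.1.label = s.1.label) :
    G.leeDiffMat k k' u s = 0 := by
  unfold leeDiffMat
  rw [Matrix.of_apply]
  refine Finset.sum_eq_zero fun i _ ↦ ?_
  rw [if_neg]
  exact fun hi ↦ h ⟨i, hi⟩

/-- A nonzero entry of `leeDiffMat` into the generator `u` forces the flipped chord to be free
for the labelling of `u`. [folklore] -/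
theorem free_of_leeDiffMat_ne_zero {k k' : ℤ} (u : G.degStates k') (s : G.degStates k)
    (h : G.leeDiffMat k k' u s ≠ 0) :
    ∃ i, s.1.state i = false ∧ u.1.state = Function.update s.1.state i true ∧
      u.1.label = s.1.label ∧ G.Free u.1.label i := by
  by_contra hne
  apply h
  apply leeDiffMat_apply_eq_zero
  rintro ⟨i, hi, hu, hl⟩
  refine hne ⟨i, hi, hu, hl, ?_⟩
  have h1 : G.IsLabelOf s.1.state u.1.label := hl ▸ s.1.isLabelOf
  have h2 : G.IsLabelOf (Function.update s.1.state i true) u.1.label := hu ▸ u.1.isLabelOf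
  exact (isLabelOf_update_iff h1 (by simp [hi])).1 h2

/-! ## The homotopy and the projector -/

variable (G) in
/-- **The homotopy contracting the free cubes.** From degree `k'` to degree `k`: the generator
`(σ, ℓ)` is sent to `(ε(τ, i₀) · leeCoef τ i₀ ℓ)⁻¹ · (τ, ℓ)`, `τ = σ[i₀ ↦ 0]`, when the *least
free chord* `i₀ = Fin.find (Free ℓ ·)` of its labelling is `1`-smoothed in `σ`, and to `0`
otherwise (no free chord, or `σ i₀ = 0`). Under the merge/split dichotomy the coefficient is the
inverse of the corresponding entry of `leeDiffMat` (`leeCoef_ne_zero`). Standard contraction of a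
cube with invertible edges; Lee (2005), §4.4.3; Bar-Natan–Morrison (2006). [cite: Lee2005, Thm. 4.2] -/
def leeHtpyMat (k' k : ℤ) : Matrix (G.degStates k) (G.degStates k') ℚ :=
  Matrix.of fun t s' ↦
    if h : ∃ i, G.Free s'.1.label i then
      (if s'.1.state (Fin.find _ h) = true ∧
          t.1.state = Function.update s'.1.state (Fin.find _ h) false ∧ t.1.label = s'.1.label then
        ((edgeSign t.1.state (Fin.find _ h) : ℚ) * G.leeCoef t.1.state (Fin.find _ h) t.1.label)⁻¹
      else 0)
    else 0

/-- The least free chord depends only on the labelling. [folklore] -/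
theorem find_free_congr {ℓ ℓ' : G.Arc → Bool} (h : ℓ = ℓ') (hex : ∃ i, G.Free ℓ i)
    (hex' : ∃ i, G.Free ℓ' i) :
    Fin.find (fun i ↦ G.Free ℓ i) hex = Fin.find (fun i ↦ G.Free ℓ' i) hex' := by
  subst h
  rfl

variable (G) in
/-- **The projector onto Lee's canonical generators**: the diagonal matrix with entry `1` at the
generators whose labelling has no free chord and `0` elsewhere. Lee (2005), §4.4.3;
Rasmussen (2010), §2.3. [cite: Lee2005, Thm. 4.2] -/
def leeProjMat (k : ℤ) : Matrix (G.degStates k) (G.degStates k) ℚ :=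
  Matrix.diagonal fun s ↦ if ∀ i, ¬ G.Free s.1.label i then 1 else 0

/-- `Π² = Π`. [folklore] -/
theorem leeProjMat_mul_leeProjMat (k : ℤ) : G.leeProjMat k * G.leeProjMat k = G.leeProjMat k := by
  unfold leeProjMat
  rw [Matrix.diagonal_mul_diagonal]
  congr 1
  funext s
  split_ifs <;> norm_num

/-- `D Π = 0`: a generator with no free chord has zero Lee differential. [folklore] -/
theorem leeDiffMat_mul_leeProjMat (k k' : ℤ) : G.leeDiffMat k k' * G.leeProjMat k = 0 := by
  ext u s
  unfold leeProjMat
  rw [Matrix.mul_diagonal, Matrix.zero_apply]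
  split_ifs with h
  · rw [mul_one]
    by_contra hne
    obtain ⟨i, -, -, hl, hf⟩ := free_of_leeDiffMat_ne_zero u s hne
    exact h i (hl ▸ hf)
  · rw [mul_zero]

/-- `Π D = 0`: the image of the Lee differential is spanned by generators with a free chord.
[folklore] -/
theorem leeProjMat_mul_leeDiffMat (k k' : ℤ) : G.leeProjMat k' * G.leeDiffMat k k' = 0 := by
  ext u s
  unfold leeProjMat
  rw [Matrix.diagonal_mul, Matrix.zero_apply]
  split_ifs with h
  · rw [one_mul]
    by_contra hne
    obtain ⟨i, -, -, -, hf⟩ := free_of_leeDiffMat_ne_zero u s hne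
    exact h i hf
  · rw [zero_mul]

/-! ## Raising and lowering a generator along a free chord -/

/-- Turning a `1`-smoothing off lowers the weight by one. [folklore] -/
theorem State.weight_update_false {σ : G.State} {i : Fin G.n} (hi : σ i = true) :
    State.weight (Function.update σ i false) + 1 = σ.weight := by
  have h := State.weight_update (σ := Function.update σ i false) (i := i) (by simp)
  rw [Function.update_idem, Function.update_eq_self_iff.2 hi.symm] at h
  exact h.symm

/-- The generator obtained by turning the free chord `i` off exists in degree `k - 1`.
[folklore] -/
theorem exists_lower {k : ℤ} (s : G.degStates k) {i : Fin G.n} (hf : G.Free s.1.label i)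
    (hi : s.1.state i = true) :
    ∃ t : G.degStates (k - 1), t.1.state = Function.update s.1.state i false ∧
      t.1.label = s.1.label := by
  have hl : G.IsLabelOf (Function.update s.1.state i false) s.1.label :=
    (isLabelOf_update_iff s.1.isLabelOf (by simp [hi])).2 hf
  refine ⟨⟨⟨_, _, hl⟩, ?_⟩, rfl, rfl⟩
  have h2 := s.2
  rw [homDegree] at h2 ⊢
  have h3 := State.weight_update_false hi
  simp only
  omega

/-- The generator obtained by turning the free chord `i` on exists in degree `k + 1`.
[folklore] -/
theorem exists_raise {k : ℤ} (s : G.degStates k) {i : Fin G.n} (hf : G.Free s.1.label i)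
    (hi : s.1.state i = false) :
    ∃ u : G.degStates (k + 1), u.1.state = Function.update s.1.state i true ∧
      u.1.label = s.1.label := by
  have hl : G.IsLabelOf (Function.update s.1.state i true) s.1.label :=
    (isLabelOf_update_iff s.1.isLabelOf (by simp [hi])).2 hf
  refine ⟨⟨⟨_, _, hl⟩, ?_⟩, rfl, rfl⟩
  have h2 := s.2
  rw [homDegree] at h2 ⊢
  rw [State.weight_update hi]
  push_cast
  omega

/-! ## Columns of the homotopy -/

/-- The entries `H(t, s')` vanish when the labelling of `s'` has no free chord. [folklore] -/
theorem leeHtpyMat_apply_of_not_exists {k k' : ℤ} (t : G.degStates k) (s' : G.degStates k')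
    (h : ¬ ∃ i, G.Free s'.1.label i) : G.leeHtpyMat k' k t s' = 0 := by
  unfold leeHtpyMat
  rw [Matrix.of_apply, dif_neg h]

/-- The entries `H(t, s')` when the least free chord `i₀` of the labelling of `s'` is known.
[folklore] -/
theorem leeHtpyMat_apply_of_exists {k k' : ℤ} (t : G.degStates k) (s' : G.degStates k')
    (h : ∃ i, G.Free s'.1.label i) {i₀ : Fin G.n} (hi₀ : Fin.find (fun i ↦ G.Free s'.1.label i) h = i₀) :
    G.leeHtpyMat k' k t s' =
      if s'.1.state i₀ = true ∧ t.1.state = Function.update s'.1.state i₀ false ∧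
          t.1.label = s'.1.label then
        ((edgeSign t.1.state i₀ : ℚ) * G.leeCoef t.1.state i₀ t.1.label)⁻¹
      else 0 := by
  unfold leeHtpyMat
  rw [Matrix.of_apply, dif_pos h, hi₀]

/-- **`(D H)(s, s')`**: zero unless the least free chord `i₀` of `ℓ'` is `1`-smoothed in `σ'`,
and then `D(s, t*) / κ(t*)` for the lowered generator `t* = (σ'[i₀ ↦ 0], ℓ')`. [folklore] -/
theorem leeDiffMat_mul_leeHtpyMat_apply {k : ℤ} (s s' : G.degStates k) {i₀ : Fin G.n}
    (hex : ∃ i, G.Free s'.1.label i) (h : Fin.find (fun i ↦ G.Free s'.1.label i) hex = i₀)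
    (t : G.degStates (k - 1))
    (ht : t.1.state = Function.update s'.1.state i₀ false) (htl : t.1.label = s'.1.label)
    (hi : s'.1.state i₀ = true) :
    (G.leeDiffMat (k - 1) k * G.leeHtpyMat k (k - 1)) s s' =
      G.leeDiffMat (k - 1) k s t *
        ((edgeSign t.1.state i₀ : ℚ) * G.leeCoef t.1.state i₀ t.1.label)⁻¹ := by
  rw [Matrix.mul_apply, Finset.sum_eq_single t]
  · rw [leeHtpyMat_apply_of_exists t s' hex h, if_pos ⟨hi, ht, htl⟩]
  · intro t' _ ht'
    rw [leeHtpyMat_apply_of_exists t' s' hex h, if_neg, mul_zero]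
    rintro ⟨-, h1, h2⟩
    exact ht' (Subtype.ext (EnhancedState.ext' (h1.trans ht.symm) (h2.trans htl.symm)))
  · exact fun h' ↦ absurd (Finset.mem_univ t) h'

/-- `(D H)(s, s') = 0` when `ℓ'` has no free chord. [folklore] -/
theorem leeDiffMat_mul_leeHtpyMat_apply_of_none {k : ℤ} (s s' : G.degStates k)
    (h : ¬ ∃ i, G.Free s'.1.label i) :
    (G.leeDiffMat (k - 1) k * G.leeHtpyMat k (k - 1)) s s' = 0 := by
  rw [Matrix.mul_apply]
  exact Finset.sum_eq_zero fun t _ ↦ by rw [leeHtpyMat_apply_of_not_exists t s' h, mul_zero]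

/-- `(D H)(s, s') = 0` when the least free chord of `ℓ'` is `0`-smoothed in `σ'`. [folklore] -/
theorem leeDiffMat_mul_leeHtpyMat_apply_of_false {k : ℤ} (s s' : G.degStates k) {i₀ : Fin G.n}
    (hex : ∃ i, G.Free s'.1.label i) (h : Fin.find (fun i ↦ G.Free s'.1.label i) hex = i₀)
    (hi : s'.1.state i₀ = false) :
    (G.leeDiffMat (k - 1) k * G.leeHtpyMat k (k - 1)) s s' = 0 := by
  rw [Matrix.mul_apply]
  refine Finset.sum_eq_zero fun t _ ↦ ?_
  rw [leeHtpyMat_apply_of_exists t s' hex h, if_neg, mul_zero]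
  rintro ⟨h1, -⟩
  rw [hi] at h1
  exact Bool.false_ne_true h1

/-- **`(H D)(s, s')`**: zero unless the least free chord `i₀` of `ℓ` is `0`-smoothed in `σ`,
and then `D(u*, s') / κ(s)` for the raised generator `u* = (σ[i₀ ↦ 1], ℓ)`. [folklore] -/
theorem leeHtpyMat_mul_leeDiffMat_apply {k : ℤ} (s s' : G.degStates k) {i₀ : Fin G.n}
    (hex : ∃ i, G.Free s.1.label i) (h : Fin.find (fun i ↦ G.Free s.1.label i) hex = i₀)
    (u : G.degStates (k + 1))
    (hu : u.1.state = Function.update s.1.state i₀ true) (hul : u.1.label = s.1.label)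
    (hi : s.1.state i₀ = false) :
    (G.leeHtpyMat (k + 1) k * G.leeDiffMat k (k + 1)) s s' =
      ((edgeSign s.1.state i₀ : ℚ) * G.leeCoef s.1.state i₀ s.1.label)⁻¹ *
        G.leeDiffMat k (k + 1) u s' := by
  rw [Matrix.mul_apply, Finset.sum_eq_single u]
  · have hexu : ∃ i, G.Free u.1.label i := by rw [hul]; exact hex
    have hf : Fin.find (fun i ↦ G.Free u.1.label i) hexu = i₀ :=
      (find_free_congr hul hexu hex).trans h
    have hs : s.1.state = Function.update u.1.state i₀ false := by
      rw [hu, Function.update_idem]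
      exact (Function.update_eq_self_iff.2 hi.symm).symm
    rw [leeHtpyMat_apply_of_exists s u hexu hf, if_pos ⟨by rw [hu]; simp, hs, hul.symm⟩]
  · intro u' _ hu'
    by_cases hlab : s.1.label = u'.1.label
    · have hexu : ∃ i, G.Free u'.1.label i := by rw [← hlab]; exact hex
      have hf : Fin.find (fun i ↦ G.Free u'.1.label i) hexu = i₀ :=
        (find_free_congr hlab.symm hexu hex).trans h
      rw [leeHtpyMat_apply_of_exists s u' hexu hf, if_neg, zero_mul]
      rintro ⟨h1, h2, -⟩
      apply hu'
      apply Subtype.ext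
      refine EnhancedState.ext' ?_ (hlab.symm.trans hul.symm)
      rw [hu, h2, Function.update_idem]
      exact (Function.update_eq_self_iff.2 h1.symm).symm
    · -- different labellings: the label condition in `H(s, u')` fails
      unfold leeHtpyMat
      rw [Matrix.of_apply]
      split_ifs with h1 h2
      · exact absurd h2.2.2 hlab
      · rw [zero_mul]
      · rw [zero_mul]
  · exact fun h' ↦ absurd (Finset.mem_univ u) h'

/-- `(H D)(s, s') = 0` when `ℓ` has no free chord. [folklore] -/
theorem leeHtpyMat_mul_leeDiffMat_apply_of_none {k : ℤ} (s s' : G.degStates k)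
    (h : ¬ ∃ i, G.Free s.1.label i) :
    (G.leeHtpyMat (k + 1) k * G.leeDiffMat k (k + 1)) s s' = 0 := by
  rw [Matrix.mul_apply]
  refine Finset.sum_eq_zero fun u _ ↦ ?_
  unfold leeHtpyMat
  rw [Matrix.of_apply]
  split_ifs with h1 h2
  · exact absurd (h2.2.2 ▸ h1) h
  · rw [zero_mul]
  · rw [zero_mul]

/-- `(H D)(s, s') = 0` when the least free chord of `ℓ` is `1`-smoothed in `σ`. [folklore] -/
theorem leeHtpyMat_mul_leeDiffMat_apply_of_true {k : ℤ} (s s' : G.degStates k) {i₀ : Fin G.n}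
    (hex : ∃ i, G.Free s.1.label i) (h : Fin.find (fun i ↦ G.Free s.1.label i) hex = i₀)
    (hi : s.1.state i₀ = true) :
    (G.leeHtpyMat (k + 1) k * G.leeDiffMat k (k + 1)) s s' = 0 := by
  rw [Matrix.mul_apply]
  refine Finset.sum_eq_zero fun u _ ↦ ?_
  by_cases hlab : s.1.label = u.1.label
  · have hexu : ∃ i, G.Free u.1.label i := by rw [← hlab]; exact hex
    have hf : Fin.find (fun i ↦ G.Free u.1.label i) hexu = i₀ :=
      (find_free_congr hlab.symm hexu hex).trans h
    rw [leeHtpyMat_apply_of_exists s u hexu hf, if_neg, zero_mul]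
    rintro ⟨-, h2, -⟩
    have h3 := congrFun h2 i₀
    rw [Function.update_self, hi] at h3
    exact Bool.noConfusion h3
  · unfold leeHtpyMat
    rw [Matrix.of_apply]
    split_ifs with h1 h2
    · exact absurd h2.2.2 hlab
    · rw [zero_mul]
    · rw [zero_mul]

/-! ## The homotopy identity -/

/-- **`D H + H D = 1 - Π`** in every degree `k` (given the merge/split dichotomy): the Lee
differential in Lee's coordinates is chain-homotopically trivial off Lee's canonical generators.
On a generator `(σ, ℓ)`: if `ℓ` has no free chord both sides vanish; otherwise, with `i₀` the
least free chord of `ℓ`, the diagonal terms give `1` (the coefficient of the edge along `i₀` and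
its inverse), and the off-diagonal terms cancel in pairs by the anticommutativity of the faces
`{i₀, j}` (`leeFace_eq_zero`). Lee (2005), Thm. 4.2 (proof of §4.4.3, recast as a contraction);
Bar-Natan–Morrison (2006). [cite: Lee2005, Thm. 4.2] -/
theorem leeDiffMat_mul_leeHtpyMat_add
    (hD : ∀ (σ : G.State) (i : Fin G.n), σ i = false → G.IsMergeAt σ i ∨ G.IsSplitAt σ i)
    (k : ℤ) :
    G.leeDiffMat (k - 1) k * G.leeHtpyMat k (k - 1) + G.leeHtpyMat (k + 1) k * G.leeDiffMat k (k + 1)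
      = 1 - G.leeProjMat k := by
  have hκ : ∀ (σ : G.State) (i : Fin G.n) (ℓ : G.Arc → Bool), σ i = false →
      (edgeSign σ i : ℚ) * G.leeCoef σ i ℓ ≠ 0 := fun σ i ℓ hσ ↦
    mul_ne_zero (by rw [Ne, Int.cast_eq_zero]; unfold edgeSign; exact pow_ne_zero _ (by decide))
      (leeCoef_ne_zero (hD σ i hσ) ℓ)
  ext s s'
  rw [Matrix.add_apply, Matrix.sub_apply, Matrix.one_apply, leeProjMat, Matrix.diagonal_apply]
  by_cases hl : s.1.label = s'.1.label
  swap
  · -- (I) different labellings: everything vanishes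
    have hne : s ≠ s' := fun h ↦ hl (by rw [h])
    rw [if_neg hne, if_neg hne, sub_zero]
    have h1 : (G.leeDiffMat (k - 1) k * G.leeHtpyMat k (k - 1)) s s' = 0 := by
      by_cases hex : ∃ i, G.Free s'.1.label i
      · by_cases hi : s'.1.state (Fin.find _ hex) = true
        · obtain ⟨t, ht, htl⟩ := exists_lower s' (Fin.find_spec hex) hi
          rw [leeDiffMat_mul_leeHtpyMat_apply s s' hex rfl t ht htl hi, leeDiffMat_apply_eq_zero,
            zero_mul]
          rintro ⟨i, -, -, hli⟩
          exact hl (hli.trans htl)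
        · exact leeDiffMat_mul_leeHtpyMat_apply_of_false s s' hex rfl (by simpa using hi)
      · exact leeDiffMat_mul_leeHtpyMat_apply_of_none s s' hex
    have h2 : (G.leeHtpyMat (k + 1) k * G.leeDiffMat k (k + 1)) s s' = 0 := by
      by_cases hex : ∃ i, G.Free s.1.label i
      · by_cases hi : s.1.state (Fin.find _ hex) = false
        · obtain ⟨u, hu, hul⟩ := exists_raise s (Fin.find_spec hex) hi
          rw [leeHtpyMat_mul_leeDiffMat_apply s s' hex rfl u hu hul hi, leeDiffMat_apply_eq_zero,
            mul_zero]
          rintro ⟨i, -, -, hli⟩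
          exact hl (hul.symm.trans hli)
        · exact leeHtpyMat_mul_leeDiffMat_apply_of_true s s' hex rfl (by simpa using hi)
      · exact leeHtpyMat_mul_leeDiffMat_apply_of_none s s' hex
    rw [h1, h2, add_zero]
  · -- (II) equal labellings `ℓ`
    by_cases hex : ∃ i, G.Free s'.1.label i
    swap
    · -- no free chord: both sides vanish
      have hex' : ¬ ∃ i, G.Free s.1.label i := by rw [hl]; exact hex
      have hnf : ∀ i, ¬ G.Free s.1.label i := fun i hi ↦ hex' ⟨i, hi⟩
      rw [leeDiffMat_mul_leeHtpyMat_apply_of_none s s' hex,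
        leeHtpyMat_mul_leeDiffMat_apply_of_none s s' hex', add_zero, if_pos hnf]
      split_ifs <;> ring
    · set i₀ := Fin.find (fun i ↦ G.Free s'.1.label i) hex with hi₀
      have hf : Fin.find (fun i ↦ G.Free s'.1.label i) hex = i₀ := rfl
      have hex' : ∃ i, G.Free s.1.label i := by rw [hl]; exact hex
      have hf' : Fin.find (fun i ↦ G.Free s.1.label i) hex' = i₀ := find_free_congr hl hex' hex
      have hfree : G.Free s'.1.label i₀ := Fin.find_spec hex
      have hfree' : G.Free s.1.label i₀ := by rw [hl]; exact hfree
      have hnf : ¬ ∀ i, ¬ G.Free s.1.label i := fun h ↦ h i₀ hfree'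
      rw [if_neg hnf, ite_self, sub_zero]
      by_cases hi' : s'.1.state i₀ = true
      · obtain ⟨t, ht, htl⟩ := exists_lower s' hfree hi'
        have hτi : t.1.state i₀ = false := by rw [ht]; simp
        rw [leeDiffMat_mul_leeHtpyMat_apply s s' hex hf t ht htl hi']
        by_cases hi : s.1.state i₀ = true
        · -- (IIa) the diagonal term of `D H`
          rw [leeHtpyMat_mul_leeDiffMat_apply_of_true s s' hex' hf' hi, add_zero]
          by_cases hss : s = s'
          · subst hss
            rw [if_pos rfl, leeDiffMat_apply_of_update s t hτi
              (by rw [ht, Function.update_idem, Function.update_eq_self_iff.2 hi.symm]) htl.symm]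
            exact mul_inv_cancel₀ (hκ _ _ _ hτi)
          · rw [if_neg hss, leeDiffMat_apply_eq_zero, zero_mul]
            rintro ⟨i, hti, hsi, -⟩
            by_cases hii : i = i₀
            · subst hii
              apply hss
              apply Subtype.ext
              refine EnhancedState.ext' ?_ hl
              rw [hsi, ht, Function.update_idem, Function.update_eq_self_iff.2 hi'.symm]
            · have h1 := congrFun hsi i₀
              rw [Function.update_of_ne (Ne.symm hii), ht, Function.update_self, hi] at h1
              exact Bool.noConfusion h1
        · -- (IIb) the off-diagonal terms cancel by the face identity
          have hi0 : s.1.state i₀ = false := by simpa using hi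
          obtain ⟨u, hu, hul⟩ := exists_raise s hfree' hi0
          rw [leeHtpyMat_mul_leeDiffMat_apply s s' hex' hf' u hu hul hi0]
          have hss : s ≠ s' := by
            rintro rfl
            rw [hi0] at hi'
            exact Bool.false_ne_true hi'
          rw [if_neg hss]
          by_cases hj : ∃ j, t.1.state j = false ∧ s.1.state = Function.update t.1.state j true
          · obtain ⟨j, htj, hsj⟩ := hj
            have hji : j ≠ i₀ := by
              rintro rfl
              apply hss
              apply Subtype.ext
              refine EnhancedState.ext' ?_ hl
              rw [hsj, ht, Function.update_idem, Function.update_eq_self_iff.2 hi'.symm]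
            have hs'j : s'.1.state j = false := by
              have h1 := congrFun ht j
              rw [Function.update_of_ne hji] at h1
              rw [← h1]
              exact htj
            have huj : u.1.state = Function.update s'.1.state j true := by
              rw [hu, hsj, ht, Function.update_comm (Ne.symm hji), Function.update_idem,
                Function.update_eq_self_iff.2]
              rw [Function.update_of_ne (Ne.symm hji)]
              exact hi'.symm
            have hs's : s'.1.state = Function.update t.1.state i₀ true := by
              rw [ht, Function.update_idem, Function.update_eq_self_iff.2 hi'.symm]
            rw [leeDiffMat_apply_of_update s t htj hsj (hl.trans htl.symm),
              leeDiffMat_apply_of_update u s' hs'j huj (hul.trans hl)]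
            -- the face `{j, i₀}` at `τ = t.state`
            have hℓτ : G.IsLabelOf t.1.state s'.1.label := htl ▸ t.1.isLabelOf
            have hfj : G.Free s'.1.label j := by
              have h1 : G.IsLabelOf (Function.update t.1.state j true) s'.1.label := by
                rw [← hsj, ← hl]
                exact s.1.isLabelOf
              exact (isLabelOf_update_iff hℓτ (by simp [htj])).1 h1
            have face := leeFace_eq_zero hji htj hτi hℓτ hfj hfree hD
            have hb := hκ t.1.state i₀ s'.1.label hτi
            have hd := hκ (Function.update t.1.state j true) i₀ s'.1.label
              (by rw [Function.update_of_ne (Ne.symm hji)]; exact hτi)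
            rw [htl, hsj, hl, hs's]
            set a := (edgeSign t.1.state j : ℚ) * G.leeCoef t.1.state j s'.1.label with ha
            set b := (edgeSign t.1.state i₀ : ℚ) * G.leeCoef t.1.state i₀ s'.1.label with hb₀
            set c' := (edgeSign (Function.update t.1.state i₀ true) j : ℚ) *
              G.leeCoef (Function.update t.1.state i₀ true) j s'.1.label with hc'
            set d := (edgeSign (Function.update t.1.state j true) i₀ : ℚ) *
              G.leeCoef (Function.update t.1.state j true) i₀ s'.1.label with hd₀
            have hb' : b * b⁻¹ = 1 := mul_inv_cancel₀ hb
            have hd' : d * d⁻¹ = 1 := mul_inv_cancel₀ hd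
            linear_combination (b⁻¹ * d⁻¹) * face - (a * b⁻¹) * hd' - (c' * d⁻¹) * hb'
          · -- no chord relates `t` to `s`: both terms vanish
            rw [leeDiffMat_apply_eq_zero s t (by
                rintro ⟨i, hti, hsi, -⟩
                exact hj ⟨i, hti, hsi⟩), zero_mul, zero_add,
              leeDiffMat_apply_eq_zero u s' ?_, mul_zero]
            rintro ⟨j', hs'j', huj', -⟩
            apply hj
            have hji : j' ≠ i₀ := by
              rintro rfl
              rw [hi'] at hs'j'
              exact Bool.noConfusion hs'j'
            refine ⟨j', ?_, ?_⟩
            · rw [ht, Function.update_of_ne hji]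
              exact hs'j'
            · have h1 : s.1.state = Function.update u.1.state i₀ false := by
                rw [hu, Function.update_idem, Function.update_eq_self_iff.2 hi0.symm]
              rw [h1, huj', ht, Function.update_comm hji]
      · -- the least free chord is `0`-smoothed in `σ'`
        have hi'0 : s'.1.state i₀ = false := by simpa using hi'
        rw [leeDiffMat_mul_leeHtpyMat_apply_of_false s s' hex hf hi'0, zero_add]
        by_cases hi : s.1.state i₀ = false
        · -- (IIc) the diagonal term of `H D`
          obtain ⟨u, hu, hul⟩ := exists_raise s hfree' hi
          rw [leeHtpyMat_mul_leeDiffMat_apply s s' hex' hf' u hu hul hi]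
          by_cases hss : s = s'
          · subst hss
            rw [if_pos rfl, leeDiffMat_apply_of_update u s hi hu hul, inv_mul_cancel₀ (hκ _ _ _ hi)]
          · rw [if_neg hss, leeDiffMat_apply_eq_zero u s' ?_, mul_zero]
            rintro ⟨j, hs'j, huj, -⟩
            have h1 := hu.symm.trans huj
            by_cases hji : j = i₀
            · subst hji
              apply hss
              apply Subtype.ext
              refine EnhancedState.ext' ?_ hl
              funext x
              by_cases hx : x = i₀
              · subst hx
                rw [hi, hs'j]
              · have h2 := congrFun h1 x
                rwa [Function.update_of_ne hx, Function.update_of_ne hx] at h2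
            · have h2 := congrFun h1 i₀
              rw [Function.update_self, Function.update_of_ne (Ne.symm hji), hi'0] at h2
              exact Bool.noConfusion h2
        · -- (IId) nothing
          have hi1 : s.1.state i₀ = true := by simpa using hi
          rw [leeHtpyMat_mul_leeDiffMat_apply_of_true s s' hex' hf' hi1]
          have hss : s ≠ s' := by
            rintro rfl
            rw [hi1] at hi'0
            exact Bool.noConfusion hi'0
          rw [if_neg hss]

end GaussDiagram

end Literature.Topology.FourManifolds
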